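import Summits.QuantumFields.YangMills.Theorems.GronwallGapContinuumFromLatticeGapDecayOfRPSpectralLocal
import Summits.QuantumFields.YangMills.Theorems.MirrorModularBoostsHypercubicLimitOfLineInputs
import Summits.QuantumFields.YangMills.Theorems.ScalingWindowSplitExistenceLegFromLattice
import HarnessLib

/-!
# `ContinuumFromLatticeGap` (stmt-QuantumFields-15915), line `registered`, reshape 5: `stub_oneFieldClausesLocal` — the existence
# leg's closure and renormalisation seam over the LOCAL RP-spectral class

Support file for the crux item stmt-QuantumFields-15915 (`GronwallGap.ContinuumFromLatticeGap`), reshape 5 of line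
`registered`.  The landed existence leg reads conjunct (b) of `IRInputs` (RP-spectral relative clustering of reflected
slab functionals, spatially GLOBAL class) in exactly one place, the decay leg; with that leg re-proved over the LOCAL
class (`stub_decayOfRPSpectralLocal`, previous file), this file re-threads the closure with `IRInputs` unbundled and (b)
local (`oneFieldClauses_of_uniformMomentBoundsPlanes_local`: functional bounds ⇒ plane limits ⇒ soft half ∧ reflection
half ⇒ `OneFieldClauses` on a sub-scheme) and the renormalisation seam of route `ScalingWindowSplit`
(`oneField_of_latticeInequalities_local`, verbatim the landed seam with the local clause; registered anchor
`stub_oneFieldClausesLocal` = the closed form of the closure step).  No definitions, no named facts.  Refs: GlimmJaffe1987 §6.1, §19.1;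
OsterwalderSeiler1978 §2; OsterwalderSchrader1973/1975.
-/

noncomputable section

open scoped SchwartzMap BigOperators Topology Classical MeasureTheory ProbabilityTheory Matrix
open MeasureTheory ProbabilityTheory Filter Topology
open Literature.MathematicalPhysics.AQFT Literature.MathematicalPhysics.QuantumLattice
open Literature.MathematicalPhysics.QuantumFieldTheory
open Summit.QuantumFields.YangMills.Cruxes.HypercubicLimit.CouplingResponse
open Summit.QuantumFields.YangMills.Cruxes.OSLegsFromFemtoAndGap.DlrCollarTransfer (conn Decay RPPos ConnCS)
open Summit.QuantumFields.YangMills.Theorems.WeakCouplingHypercubicLimit.TraceNormColdPressure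
  (reflHalf_of_pieces stub_rpPosOfPlaneLimits stub_signedPermOfPlaneLimits)
open Summit.QuantumFields.YangMills.Theorems.ScalingWindowSplit
  (trunc_rescale tsupport_thetaTest_pos' uniformMomentBoundsPlanes_subseq)

namespace Summit.QuantumFields.YangMills.Theorems.ContinuumFromLatticeGap

/-! ## The closure of the one-field clauses over the LOCAL class -/

section Chain

variable {G : Type} [Group G] [TopologicalSpace G] [IsTopologicalGroup G] [CompactSpace G]
  [MeasurableSpace G] [BorelSpace G]

/-- **The closure of the existence leg from its landed pieces, over the LOCAL RP-spectral class** (the twin of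
`CouplingResponse.oneFieldClauses_of_uniformMomentBoundsPlanes` with `IRInputs` unbundled and its conjunct (b) restricted
to the local functional class): a weak-coupling scheme with polynomial volume growth and renormalisation, bounded
counterterms, the `k`-uniform plane-resolved `n!`-moment bounds, the uniform lattice gap at rate `Δ`, LOCAL RP-spectral
clustering at rate `Δ`, and the non-triviality and `κ₃` floors yields a sub-scheme (still at weak coupling) and a one-field
family with `OneFieldClauses`.  Chain (all landed but the decay leg, which is `stub_decayOfRPSpectralLocal`): functional
bounds ⇒ plane limits ⇒ soft half (E0, E0′, E3, translations, convergence, the two floors, the lattice gap on the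
sub-scheme) ∧ reflection half (`reflHalf_of_pieces` fed `stub_rpPosOfPlaneLimits`, `stub_signedPermOfPlaneLimits` and the
LOCAL decay leg) ⇒ `oneFieldClauses_of_halves`.
-- adapted from Theorems/MirrorModularBoostsHypercubicLimitOfLineInputs.lean [folklore] -/
theorem oneFieldClauses_of_uniformMomentBoundsPlanes_local
    (r : LatticeRep G) (sch : SpeciesScheme (YMSpecies G)) (hw : sch.HasWeakCouplingLimit) (hpv : PolyVolume sch)
    (hpr : PolyRenorm r sch) (hbm : ∃ Cm : ℝ, ∀ k, |sch.m r.curvature k| ≤ Cm) (hUMB : UniformMomentBoundsPlanes r sch)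
    {Δ C : ℝ} (hΔ : 0 < Δ) (hgap : HasLatticeMassGap r sch Δ)
    (hrp : (∀ᶠ k in atTop, ∀ (S₀ T₀ n R : ℕ), sch.L k ≤ S₀ → 2 * (T₀ + n + 1) ≤ S₀ → 2 * (R + 1) ≤ S₀ →
        ∀ (Y : LGConfig 4 G → ℝ) (B : ℝ), Measurable Y → (∀ U, |Y U| ≤ B) →
          DependsOn Y {e : Literature.MathematicalPhysics.QuantumLattice.ZdEdge 4 |
            (1 ≤ e.1 0 ∧ e.1 0 + (if e.2 = 0 then 1 else 0) ≤ T₀) ∧ ∀ i : Fin 4, i ≠ 0 → |e.1 i| ≤ R} →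
          |(∫ U, Y (torusLift (2 * S₀ + 1) (GaugeConfig.timeReflect U)) *
                Y (configShift (-Pi.single 0 (n : ℤ)) (torusLift (2 * S₀ + 1) U))
              ∂(wilsonMeasure r.ρ (sch.β k) : Measure (GaugeConfig 4 (2 * S₀ + 1) G))) -
            (∫ U, Y (torusLift (2 * S₀ + 1) U)
              ∂(wilsonMeasure r.ρ (sch.β k) : Measure (GaugeConfig 4 (2 * S₀ + 1) G))) ^ 2| ≤
            Real.exp (-(Δ * sch.a k * n)) *
              ((∫ U, Y (torusLift (2 * S₀ + 1) (GaugeConfig.timeReflect U)) * Y (torusLift (2 * S₀ + 1) U)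
                  ∂(wilsonMeasure r.ρ (sch.β k) : Measure (GaugeConfig 4 (2 * S₀ + 1) G))) -
                (∫ U, Y (torusLift (2 * S₀ + 1) U)
                  ∂(wilsonMeasure r.ρ (sch.β k) : Measure (GaugeConfig 4 (2 * S₀ + 1) G))) ^ 2) +
            C * B ^ 2 * Real.exp (-(Δ * sch.a k * S₀))))
    (hNT : (∃ (u v : 𝓢(EuclideanSpace ℝ (Fin 4), ℝ)) (δ : ℝ),
      tsupport u ⊆ {y : EuclideanSpace ℝ (Fin 4) | y 0 < 0} ∧
      tsupport v ⊆ {y : EuclideanSpace ℝ (Fin 4) | 0 < y 0} ∧ 0 < δ ∧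
      ∀ᶠ k in atTop, δ ≤
        |latticeSchwinger r.ρ sch (fun s => s.F) k (1 + 1) (fun _ => r.curvature) ![u, v] -
          latticeSchwinger r.ρ sch (fun s => s.F) k 1 (fun _ => r.curvature) ![u] *
            latticeSchwinger r.ρ sch (fun s => s.F) k 1 (fun _ => r.curvature) ![v]|))
    (hNG : (∃ (f g h : 𝓢(EuclideanSpace ℝ (Fin 4), ℝ)) (δ : ℝ),
      Disjoint (tsupport f) (tsupport g) ∧ Disjoint (tsupport f) (tsupport h) ∧
      Disjoint (tsupport g) (tsupport h) ∧ 0 < δ ∧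
      ∀ᶠ k in atTop, δ ≤
        |latticeSchwinger r.ρ sch (fun s => s.F) k 3 (fun _ => r.curvature) ![f, g, h] -
          latticeSchwinger r.ρ sch (fun s => s.F) k 1 (fun _ => r.curvature) ![f] *
            latticeSchwinger r.ρ sch (fun s => s.F) k 2 (fun _ => r.curvature) ![g, h] -
          latticeSchwinger r.ρ sch (fun s => s.F) k 1 (fun _ => r.curvature) ![g] *
            latticeSchwinger r.ρ sch (fun s => s.F) k 2 (fun _ => r.curvature) ![f, h] -
          latticeSchwinger r.ρ sch (fun s => s.F) k 1 (fun _ => r.curvature) ![h] *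
            latticeSchwinger r.ρ sch (fun s => s.F) k 2 (fun _ => r.curvature) ![f, g] +
          2 * (latticeSchwinger r.ρ sch (fun s => s.F) k 1 (fun _ => r.curvature) ![f] *
            latticeSchwinger r.ρ sch (fun s => s.F) k 1 (fun _ => r.curvature) ![g] *
            latticeSchwinger r.ρ sch (fun s => s.F) k 1 (fun _ => r.curvature) ![h])|)) :
    ∃ (sch' : SpeciesScheme (YMSpecies G)) (S₁ : SchwingerFamily (EuclideanSpace ℝ (Fin 4))),
      sch'.HasWeakCouplingLimit ∧ OneFieldClauses r sch' S₁ := by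
  have hUFB : UniformFunctionalBoundPlanes r sch := stub_functionalBoundPlanes G r sch hpv hUMB
  obtain ⟨φ, hφ, T, hPL⟩ := stub_planeLimits G r sch hUFB
  -- the soft half on the sub-scheme
  obtain ⟨hE0, hE3⟩ := planeSum_isNormalized_isSymmetric G r sch φ T hPL
  have hE0' := planeSum_hasLinearGrowth G r sch φ T hPL
  have hconv := convergence_subseq_of_planeLimits G r sch φ hφ T hPL
  have htr := stub_translationPlanesMono G r sch φ hφ T hpv hpr hUFB hPL
  obtain ⟨u, v, δ, hu, hv, hδ, hfl⟩ := hNT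
  obtain ⟨f, g, h3, δ', hfg, hfh, hgh, hδ', hfl3⟩ := hNG
  have hNT' := nontrivialClause_of_latticeFloor G r (subseq sch φ hφ) (planeSum T) hconv
    ⟨u, v, δ, hu, hv, hδ, eventually_subseq hφ hfl⟩
  have hNG' := nonGaussianClause_of_latticeFloor G r (subseq sch φ hφ) (planeSum T) hconv
    ⟨f, g, h3, δ', hfg, hfh, hgh, hδ', eventually_subseq hφ hfl3⟩
  have hsoft : SoftHalf r (subseq sch φ hφ) (planeSum T) Δ :=
    ⟨hE0, hE0', hE3, fun n _ a F hF => htr n a F hF, hconv, hNT', hNG', hasLatticeMassGap_subseq r sch φ hφ hgap⟩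
  -- the reflection half, with the LOCAL decay leg
  have hβ0 : ∀ᶠ k in atTop, 0 ≤ sch.β k := hw.eventually_ge_atTop 0
  have hrefl : ReflHalf (planeSum T) Δ :=
    reflHalf_of_pieces (planeSum T) hΔ hE0 (fun n _ a F hF => htr n a F hF)
      (stub_rpPosOfPlaneLimits G r sch φ hφ T hβ0 hUFB hPL)
      (stub_signedPermOfPlaneLimits G r sch φ hφ T hUFB hPL)
      (stub_decayOfRPSpectralLocal G r sch φ hφ T Δ C hΔ hpv hpr hbm hUFB hPL hrp)
  exact ⟨subseq sch φ hφ, planeSum T, hasWeakCouplingLimit_subseq sch φ hφ hw,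
    oneFieldClauses_of_halves r _ _ hΔ hsoft hrefl⟩

end Chain

/-! ## The renormalisation seam over the LOCAL class -/

section Seam

variable {G : Type} [Group G] [TopologicalSpace G] [IsTopologicalGroup G] [CompactSpace G] [MeasurableSpace G]
  [BorelSpace G]

/-- **The seam over the LOCAL class, assembled: from the three lattice inequalities at one witness to the one-field
clauses** (the twin of `ScalingWindowSplit.oneField_of_latticeInequalities` with the RP-spectral hypothesis restricted to
the LOCAL functional class — slab functionals supported in a spatial box of half-side `R`, `2(R+1) ≤ S₀`).
Given `r`, a scheme `sch` at weak coupling with polynomial volume growth, `Δ > 0` with the uniform lattice gap and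
its RP-spectral form, a negative-time bump `u` with the polynomial floor and the window of the BARE truncated
two-point function `T⁰_k(u, θu)`, the `k`-uniform plane-resolved moment bounds of the SELF-NORMALISED scheme
`canon` (`c'_k = 1/√T⁰_k(u,θu)`, `m'_k = ⟨tr U_p⟩_k`) and a `κ₃` floor for `canon`: there are a sub-scheme at weak
coupling and a one-field Schwinger family with `OneFieldClauses`.  Proof: `T^canon_k(u,θu) = c'_k² T⁰_k = 1` on the
tail where the floor holds (`trunc_rescale`) gives clause (c) of `IRInputs r canon` with `v = θu`, `δ = 1`; clauses
(a), (b) are those of `sch` (they read `a, β, L` only) and (d) is the hypothesis; on the tail `k ≥ k₀` (floor and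
`a_k ≤ 1`) `|c'_k| = 1/√T⁰_k ≤ a_k⁻ᵖ` (`PolyRenorm`) and `|m'_k| ≤ sup |tr F²|`; the tail sub-scheme
`subseq canon (· + k₀)` keeps weak coupling, polynomial volumes, the moment bounds and `IRInputs`, so the landed
`oneFieldClauses_of_uniformMomentBoundsPlanes_local` applies.
-- adapted from Theorems/ScalingWindowSplitExistenceLegFromLattice.lean [cite: GlimmJaffe1987, §6.1 and §19.1] -/
theorem oneField_of_latticeInequalities_local (r : LatticeRep G) (sch : SpeciesScheme (YMSpecies G))
    (u : 𝓢(EuclideanSpace ℝ (Fin 4), ℝ)) (p : ℕ) (M Δ C : ℝ) :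
    let bare : SpeciesScheme (YMSpecies G) := { sch with c := fun _ _ => 1, m := fun _ _ => 0 }
    let T : 𝓢(EuclideanSpace ℝ (Fin 4), ℝ) → ℕ → ℝ := fun w k =>
      latticeSchwinger r.ρ bare (fun s => s.F) k (1 + 1) (fun _ => r.curvature) ![w, thetaTest 4 w] -
        latticeSchwinger r.ρ bare (fun s => s.F) k 1 (fun _ => r.curvature) ![w] *
          latticeSchwinger r.ρ bare (fun s => s.F) k 1 (fun _ => r.curvature) ![thetaTest 4 w]
    let canon : SpeciesScheme (YMSpecies G) :=
      { sch with
        c := fun _ k => (Real.sqrt (T u k))⁻¹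
        m := fun _ k => ∫ U, r.curvature.F (torusLift (sch.side k) U) ∂(wilsonMeasure r.ρ (sch.β k)) }
    sch.HasWeakCouplingLimit →
    (∃ N : ℕ, 1 ≤ N ∧ ∀ᶠ k in Filter.atTop, (sch.a k)⁻¹ ≤ (sch.a k * (sch.L k : ℝ)) ^ N) →
    0 < Δ → HasLatticeMassGap r sch Δ →
    (∀ᶠ k in atTop, ∀ (S₀ T₀ n R : ℕ), sch.L k ≤ S₀ → 2 * (T₀ + n + 1) ≤ S₀ → 2 * (R + 1) ≤ S₀ →
        ∀ (Y : LGConfig 4 G → ℝ) (B : ℝ), Measurable Y → (∀ U, |Y U| ≤ B) →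
          DependsOn Y {e : Literature.MathematicalPhysics.QuantumLattice.ZdEdge 4 |
            (1 ≤ e.1 0 ∧ e.1 0 + (if e.2 = 0 then 1 else 0) ≤ T₀) ∧ ∀ i : Fin 4, i ≠ 0 → |e.1 i| ≤ R} →
          |(∫ U, Y (torusLift (2 * S₀ + 1) (GaugeConfig.timeReflect U)) *
                Y (configShift (-Pi.single 0 (n : ℤ)) (torusLift (2 * S₀ + 1) U))
              ∂(wilsonMeasure r.ρ (sch.β k) : Measure (GaugeConfig 4 (2 * S₀ + 1) G))) -
            (∫ U, Y (torusLift (2 * S₀ + 1) U)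
              ∂(wilsonMeasure r.ρ (sch.β k) : Measure (GaugeConfig 4 (2 * S₀ + 1) G))) ^ 2| ≤
            Real.exp (-(Δ * sch.a k * n)) *
              ((∫ U, Y (torusLift (2 * S₀ + 1) (GaugeConfig.timeReflect U)) * Y (torusLift (2 * S₀ + 1) U)
                  ∂(wilsonMeasure r.ρ (sch.β k) : Measure (GaugeConfig 4 (2 * S₀ + 1) G))) -
                (∫ U, Y (torusLift (2 * S₀ + 1) U)
                  ∂(wilsonMeasure r.ρ (sch.β k) : Measure (GaugeConfig 4 (2 * S₀ + 1) G))) ^ 2) +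
            C * B ^ 2 * Real.exp (-(Δ * sch.a k * S₀))) →
    tsupport u ⊆ {y : EuclideanSpace ℝ (Fin 4) | y 0 < 0} →
    (∀ᶠ k in Filter.atTop, (sch.a k) ^ p ≤ T u k ∧ T u k ≤ M * T (timeShiftTest 4 (-1) u) k) →
    (∃ (s : ℕ) (C₀ C₁ : ℝ), ∀ (n : ℕ)
        (F : Fin n → {q : Fin 4 × Fin 4 // q.1 < q.2} → 𝓢(EuclideanSpace ℝ (Fin 4), ℝ)),
      (∀ i, ∑ q, schwartzNorm s (ofRealTest (F i q)) ≤ 1) →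
      (∀ i j, i ≠ j → ∀ q q', Disjoint (tsupport (F i q)) (tsupport (F j q'))) →
      ∀ k : ℕ, |∫ U, ∏ i, ∑ q : {q : Fin 4 × Fin 4 // q.1 < q.2},
        smearedLatticeField (plaquetteObs r.ρ 0 q.1.1 q.1.2)
          (Literature.Probability.LatticeModels.box 4 (canon.L k)) (canon.a k) (canon.c r.curvature k)
          (canon.m r.curvature k / 6) (F i q) (torusLift (canon.side k) U)
        ∂(wilsonMeasure r.ρ (canon.β k) : Measure (GaugeConfig 4 (canon.side k) G))| ≤
        C₀ * C₁ ^ n * n.factorial) →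
    (∃ (f g h : 𝓢(EuclideanSpace ℝ (Fin 4), ℝ)) (δ : ℝ),
      Disjoint (tsupport f) (tsupport g) ∧ Disjoint (tsupport f) (tsupport h) ∧
      Disjoint (tsupport g) (tsupport h) ∧ 0 < δ ∧
      ∀ᶠ k in Filter.atTop, δ ≤
        |latticeSchwinger r.ρ canon (fun s => s.F) k 3 (fun _ => r.curvature) ![f, g, h] -
          latticeSchwinger r.ρ canon (fun s => s.F) k 1 (fun _ => r.curvature) ![f] *
            latticeSchwinger r.ρ canon (fun s => s.F) k 2 (fun _ => r.curvature) ![g, h] -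
          latticeSchwinger r.ρ canon (fun s => s.F) k 1 (fun _ => r.curvature) ![g] *
            latticeSchwinger r.ρ canon (fun s => s.F) k 2 (fun _ => r.curvature) ![f, h] -
          latticeSchwinger r.ρ canon (fun s => s.F) k 1 (fun _ => r.curvature) ![h] *
            latticeSchwinger r.ρ canon (fun s => s.F) k 2 (fun _ => r.curvature) ![f, g] +
          2 * (latticeSchwinger r.ρ canon (fun s => s.F) k 1 (fun _ => r.curvature) ![f] *
            latticeSchwinger r.ρ canon (fun s => s.F) k 1 (fun _ => r.curvature) ![g] *
            latticeSchwinger r.ρ canon (fun s => s.F) k 1 (fun _ => r.curvature) ![h])|) →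
    ∃ (sch' : SpeciesScheme (YMSpecies G)) (S₁ : SchwingerFamily (EuclideanSpace ℝ (Fin 4))),
      sch'.HasWeakCouplingLimit ∧ OneFieldClauses r sch' S₁ := by
  intro bare T canon hw hpv hΔ hgap hrp hu hfw hUMB hK3
  -- the tail `k ≥ k₀`: floor ∧ window, and `a_k ≤ 1`
  have ha1 : ∀ᶠ k in atTop, sch.a k ≤ 1 := sch.tendsto_a.eventually_le_const zero_lt_one
  obtain ⟨k₀, hk₀⟩ := Filter.eventually_atTop.1 (hfw.and ha1)
  have hTpos : ∀ k, k₀ ≤ k → 0 < T u k := fun k hk =>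
    (pow_pos (sch.a_pos k) p).trans_le (hk₀ k hk).1.1
  -- the seam identity for the self-normalised scheme: `T^canon_k(u, θu) = 1` on the tail
  have hone : ∀ k, k₀ ≤ k →
      latticeSchwinger r.ρ canon (fun s => s.F) k (1 + 1) (fun _ => r.curvature) ![u, thetaTest 4 u] -
          latticeSchwinger r.ρ canon (fun s => s.F) k 1 (fun _ => r.curvature) ![u] *
            latticeSchwinger r.ρ canon (fun s => s.F) k 1 (fun _ => r.curvature) ![thetaTest 4 u] = 1 := by
    intro k hk
    rw [trunc_rescale r canon k u (thetaTest 4 u)]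
    have hc : canon.c r.curvature k = (Real.sqrt (T u k))⁻¹ := rfl
    have hb : latticeSchwinger r.ρ ({ canon with c := fun _ _ => 1, m := fun _ _ => 0 } :
          SpeciesScheme (YMSpecies G)) (fun s => s.F) k (1 + 1) (fun _ => r.curvature) ![u, thetaTest 4 u] -
        latticeSchwinger r.ρ ({ canon with c := fun _ _ => 1, m := fun _ _ => 0 } :
            SpeciesScheme (YMSpecies G)) (fun s => s.F) k 1 (fun _ => r.curvature) ![u] *
          latticeSchwinger r.ρ ({ canon with c := fun _ _ => 1, m := fun _ _ => 0 } :
            SpeciesScheme (YMSpecies G)) (fun s => s.F) k 1 (fun _ => r.curvature) ![thetaTest 4 u] =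
        T u k := rfl
    rw [hc, hb, inv_pow, Real.sq_sqrt (hTpos k hk).le, inv_mul_cancel₀ (hTpos k hk).ne']
  -- the infrared inputs of `canon`: (a), (b) from `sch` (definitionally those of `canon`); (c) the identity; (d) the hypothesis
  have hgap' : HasLatticeMassGap r canon Δ := hgap
  have hfloor : ∀ᶠ k in atTop, (1 : ℝ) ≤
      |latticeSchwinger r.ρ canon (fun s => s.F) k (1 + 1) (fun _ => r.curvature) ![u, thetaTest 4 u] -
        latticeSchwinger r.ρ canon (fun s => s.F) k 1 (fun _ => r.curvature) ![u] *
          latticeSchwinger r.ρ canon (fun s => s.F) k 1 (fun _ => r.curvature) ![thetaTest 4 u]| :=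
    Filter.eventually_atTop.2 ⟨k₀, fun k hk => by rw [hone k hk, abs_one]⟩
  obtain ⟨f₃, g₃, h₃, δ₃, hfg, hfh, hgh, hδ₃, hK3'⟩ := hK3
  -- the tail sub-scheme
  have hφ : StrictMono fun k : ℕ => k + k₀ := fun a b h => Nat.add_lt_add_right h k₀
  refine oneFieldClauses_of_uniformMomentBoundsPlanes_local r (subseq canon (fun k => k + k₀) hφ)
    (hasWeakCouplingLimit_subseq canon _ hφ hw) (polyVolume_subseq canon _ hφ hpv) ?_ ?_
    (uniformMomentBoundsPlanes_subseq r canon _ hφ hUMB) hΔ (hasLatticeMassGap_subseq r canon _ hφ hgap')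
    (eventually_subseq hφ hrp)
    ⟨u, thetaTest 4 u, 1, hu, tsupport_thetaTest_pos' hu, one_pos, eventually_subseq hφ hfloor⟩
    ⟨f₃, g₃, h₃, δ₃, hfg, hfh, hgh, hδ₃, eventually_subseq hφ hK3'⟩
  · -- `PolyRenorm` on the tail: `|c'_k| = 1/√T⁰_k ≤ a_k⁻ᵖ`
    refine ⟨p, fun k => ?_⟩
    show |(Real.sqrt (T u (k + k₀)))⁻¹| ≤ (sch.a (k + k₀))⁻¹ ^ p
    obtain ⟨⟨hfl, -⟩, hak⟩ := hk₀ (k + k₀) (Nat.le_add_left k₀ k)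
    have hT : 0 < T u (k + k₀) := hTpos _ (Nat.le_add_left k₀ k)
    have ha : 0 < sch.a (k + k₀) := sch.a_pos _
    rw [abs_of_pos (inv_pos.2 (Real.sqrt_pos.2 hT)), inv_pow]
    refine inv_anti₀ (pow_pos ha p) (Real.le_sqrt_of_sq_le ?_)
    calc (sch.a (k + k₀) ^ p) ^ 2 = sch.a (k + k₀) ^ p * sch.a (k + k₀) ^ p := sq _
      _ ≤ sch.a (k + k₀) ^ p * 1 :=
        mul_le_mul_of_nonneg_left (pow_le_one₀ ha.le hak) (pow_nonneg ha.le p)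
      _ ≤ T u (k + k₀) := by rw [mul_one]; exact hfl
  · -- bounded counterterm: `|m'_k| ≤ sup |tr F²|`
    obtain ⟨Cm, hCm⟩ := r.curvature.bounded
    refine ⟨Cm, fun k => ?_⟩
    show |∫ U, r.curvature.F (torusLift (sch.side (k + k₀)) U)
        ∂(wilsonMeasure r.ρ (sch.β (k + k₀)) : Measure (GaugeConfig 4 (sch.side (k + k₀)) G))| ≤ Cm
    haveI : IsProbabilityMeasure
        (wilsonMeasure (d := 4) (L := sch.side (k + k₀)) (G := G) r.ρ (sch.β (k + k₀))) :=
      isProbabilityMeasure_wilsonMeasure r.ρ r.continuous _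
    have h := norm_integral_le_of_norm_le_const
      (μ := (wilsonMeasure r.ρ (sch.β (k + k₀)) : Measure (GaugeConfig 4 (sch.side (k + k₀)) G)))
      (f := fun U => r.curvature.F (torusLift (sch.side (k + k₀)) U)) (C := Cm)
      (ae_of_all _ fun U => by rw [Real.norm_eq_abs]; exact hCm _)
    simpa using h


end Seam

/-- **`stub_oneFieldClausesLocal`** (registered anchor of line `registered`, reshape 5 — the closure step, closed form of
`oneFieldClauses_of_uniformMomentBoundsPlanes_local`): a weak-coupling scheme with polynomial volume growth and
renormalisation, bounded counterterms, the `k`-uniform plane-resolved `n!`-moment bounds, the uniform lattice gap, LOCAL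
RP-spectral clustering and the two floors yields a sub-scheme at weak coupling with the one-field clauses. [folklore] -/
theorem stub_oneFieldClausesLocal :
    ∀ (G : Type) [Group G] [TopologicalSpace G] [IsTopologicalGroup G] [CompactSpace G] [MeasurableSpace G]
      [BorelSpace G] (r : LatticeRep G) (sch : SpeciesScheme (YMSpecies G)),
      sch.HasWeakCouplingLimit → PolyVolume sch → PolyRenorm r sch → (∃ Cm : ℝ, ∀ k, |sch.m r.curvature k| ≤ Cm) →
      UniformMomentBoundsPlanes r sch → ∀ (Δ C : ℝ), 0 < Δ → HasLatticeMassGap r sch Δ →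
      (∀ᶠ k in atTop, ∀ (S₀ T₀ n R : ℕ), sch.L k ≤ S₀ → 2 * (T₀ + n + 1) ≤ S₀ → 2 * (R + 1) ≤ S₀ →
        ∀ (Y : LGConfig 4 G → ℝ) (B : ℝ), Measurable Y → (∀ U, |Y U| ≤ B) →
          DependsOn Y {e : Literature.MathematicalPhysics.QuantumLattice.ZdEdge 4 |
            (1 ≤ e.1 0 ∧ e.1 0 + (if e.2 = 0 then 1 else 0) ≤ T₀) ∧ ∀ i : Fin 4, i ≠ 0 → |e.1 i| ≤ R} →
          |(∫ U, Y (torusLift (2 * S₀ + 1) (GaugeConfig.timeReflect U)) *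
                Y (configShift (-Pi.single 0 (n : ℤ)) (torusLift (2 * S₀ + 1) U))
              ∂(wilsonMeasure r.ρ (sch.β k) : Measure (GaugeConfig 4 (2 * S₀ + 1) G))) -
            (∫ U, Y (torusLift (2 * S₀ + 1) U)
              ∂(wilsonMeasure r.ρ (sch.β k) : Measure (GaugeConfig 4 (2 * S₀ + 1) G))) ^ 2| ≤
            Real.exp (-(Δ * sch.a k * n)) *
              ((∫ U, Y (torusLift (2 * S₀ + 1) (GaugeConfig.timeReflect U)) * Y (torusLift (2 * S₀ + 1) U)
                  ∂(wilsonMeasure r.ρ (sch.β k) : Measure (GaugeConfig 4 (2 * S₀ + 1) G))) -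
                (∫ U, Y (torusLift (2 * S₀ + 1) U)
                  ∂(wilsonMeasure r.ρ (sch.β k) : Measure (GaugeConfig 4 (2 * S₀ + 1) G))) ^ 2) +
            C * B ^ 2 * Real.exp (-(Δ * sch.a k * S₀))) →
      (∃ (u v : 𝓢(EuclideanSpace ℝ (Fin 4), ℝ)) (δ : ℝ),
      tsupport u ⊆ {y : EuclideanSpace ℝ (Fin 4) | y 0 < 0} ∧
      tsupport v ⊆ {y : EuclideanSpace ℝ (Fin 4) | 0 < y 0} ∧ 0 < δ ∧
      ∀ᶠ k in atTop, δ ≤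
        |latticeSchwinger r.ρ sch (fun s => s.F) k (1 + 1) (fun _ => r.curvature) ![u, v] -
          latticeSchwinger r.ρ sch (fun s => s.F) k 1 (fun _ => r.curvature) ![u] *
            latticeSchwinger r.ρ sch (fun s => s.F) k 1 (fun _ => r.curvature) ![v]|) →
      (∃ (f g h : 𝓢(EuclideanSpace ℝ (Fin 4), ℝ)) (δ : ℝ),
      Disjoint (tsupport f) (tsupport g) ∧ Disjoint (tsupport f) (tsupport h) ∧
      Disjoint (tsupport g) (tsupport h) ∧ 0 < δ ∧
      ∀ᶠ k in atTop, δ ≤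
        |latticeSchwinger r.ρ sch (fun s => s.F) k 3 (fun _ => r.curvature) ![f, g, h] -
          latticeSchwinger r.ρ sch (fun s => s.F) k 1 (fun _ => r.curvature) ![f] *
            latticeSchwinger r.ρ sch (fun s => s.F) k 2 (fun _ => r.curvature) ![g, h] -
          latticeSchwinger r.ρ sch (fun s => s.F) k 1 (fun _ => r.curvature) ![g] *
            latticeSchwinger r.ρ sch (fun s => s.F) k 2 (fun _ => r.curvature) ![f, h] -
          latticeSchwinger r.ρ sch (fun s => s.F) k 1 (fun _ => r.curvature) ![h] *
            latticeSchwinger r.ρ sch (fun s => s.F) k 2 (fun _ => r.curvature) ![f, g] +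
          2 * (latticeSchwinger r.ρ sch (fun s => s.F) k 1 (fun _ => r.curvature) ![f] *
            latticeSchwinger r.ρ sch (fun s => s.F) k 1 (fun _ => r.curvature) ![g] *
            latticeSchwinger r.ρ sch (fun s => s.F) k 1 (fun _ => r.curvature) ![h])|) →
      ∃ (sch' : SpeciesScheme (YMSpecies G)) (S₁ : SchwingerFamily (EuclideanSpace ℝ (Fin 4))),
        sch'.HasWeakCouplingLimit ∧ OneFieldClauses r sch' S₁ :=
  fun _ _ _ _ _ _ _ r sch hw hpv hpr hbm hUMB _ _ hΔ hgap hrp hNT hNG =>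
    oneFieldClauses_of_uniformMomentBoundsPlanes_local r sch hw hpv hpr hbm hUMB hΔ hgap hrp hNT hNG

end Summit.QuantumFields.YangMills.Theorems.ContinuumFromLatticeGap

end
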